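import Literature.AlgebraicGeometry.ModuliOfAbelianVarieties.SiegelAdmissibleOfNormalFormFrame
import Literature.AlgebraicGeometry.ModuliOfAbelianVarieties.SiegelAdelicMarkingNormalForm
import Literature.AlgebraicGeometry.Motives.AbelianVarietyPolarizationTypeAnalytic
import Literature.AlgebraicGeometry.AbelianSchemes.AbelianSchemeOverFibreDim
import Literature.AlgebraicGeometry.HodgeTheory.AbelianVarietyHodgeFullnessHolds
import Literature.AlgebraicGeometry.Motives.AbelianVarietyAmpleRiemannForm
import HarnessLib

/-!
# The (U3) existence clause `exists_isAdmissibleAt`: some principal representative is admissible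
# ([Milne 2005] Thm. 6.11; [Deligne 1971] 4.12 (b); [Lange 2023] §3.1; [MFK94] App. 7A)

Topic `AlgebraicGeometry/ModuliOfAbelianVarieties`; namespace `Literature.AlgebraicGeometry.ModuliOfAbelianVarieties`.
KERNEL ONLY: theorems; no definition, no named fact, no instance, no `sorry`.  Cell `hodgecm-mathlib`, rung-0 U-DAG
brick **B4 (d)**, FINAL assembly layer (B-plan1 R67): for a polarised abelian scheme `P′` of type `δ` with level-`N`
structure over `Spec ℂ` (`0 < g`, `N ≠ 0`) SOME principal representative `r = diag(1, u·1)` is ADMISSIBLE at SOME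
`Z ∈ 𝔥_g` (★ `IsAdmissibleAt`) — GIVEN ONLY the positivity statement «the Néron–Severi form of `[𝒪(Θ)^an]` is a Riemann
form for `Θ` ample» on the fibre (R67 (2), binder `hpos`; Lefschetz / Kodaira direction «ample ⇒ positive»).
Chain: ★ D2 `Polarization.exists_ample` (`Θ`) → ★ `complexAbelianVariety_torusUniformised_holds` (`Φ, φ`) → ★
`AHData.toPic_surjective` (`p`, Appell–Humbert) → `hpos` → ★ `HasType.complexTorus_isPolarizationType` (the type of
`P′.pol` is the analytic type of `c₁`; R67 (1)) → Frobenius basis → ★ `exists_siegelAdelicMarking_normalForm` (R67 (3):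
`Z`, frame `T`, marking by `[J(Z), 1]` with `u(v) = φ(T[ṽ])`) → ★ `exists_isAdmissibleAt_of_normalFormFrame`.
HC_CM is proved only modulo the 7 printed citations until rung 0 closes.

* `isFrobeniusBasis_of_clauses` — the real `η`-clauses of ★ `ComplexTorus.IsPolarizationType` give an integral
  Frobenius basis for `Matrix.toBilin' (intGram Φ η)` (★ `intCast_toBilin'_intGram`);
* **`exists_isAdmissibleAt_of_positivity`** — the statement above;
* **`exists_isAdmissibleAt`** — UNCONDITIONAL: the positivity binder discharged by ★
  `AbelianVariety.isRiemannForm_of_isAmple` (`AbelianVarietyAmpleRiemannForm`, R67 (2): an ample `Θ` has a non-zero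
  section of some `𝒪(dΘ)`, so `c₁` is a Riemann form by the theta-function criterion).

## References
* [Milne2005ShimuraVarieties] J. S. Milne, *Introduction to Shimura varieties* (2005), §6 Thm. 6.11 pp. 74–75, §12 (63).
* [Deligne1971TravauxShimura] P. Deligne, *Travaux de Shimura* (1971), 4.12 (b) pp. 148–149, Exemple 4.16 p. 150.
* [MumfordFogartyKirwan1994] D. Mumford, J. Fogarty, F. Kirwan, *GIT* (1994), App. 7A pp. 234–235.
* [Lange2023AbelianVarietiesComplex] H. Lange, *Abelian Varieties over the Complex Numbers* (2023), §3.1, §1.5.1.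
-/

set_option autoImplicit false

noncomputable section

open Matrix NumberField IsDedekindDomain CategoryTheory AlgebraicGeometry

namespace Literature.AlgebraicGeometry.ModuliOfAbelianVarieties

open Literature.AlgebraicGeometry.Motives (AbelianVariety AlgPoints CartierDivisor specOver ComplexPoints)
open Literature.AlgebraicGeometry.AbelianSchemes (AbelianSchemeOver PolarizedAbelianSchemeWithLevel)
open Literature.Geometry.Kaehler (ComplexTorus)
open Literature.Geometry.Kaehler.ComplexTorus (AHData proj mapMatrix intGram picClass IsRiemannForm IsNSForm intVec)
open Literature.NumberTheory.Transcendental (IsAnalytification)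
open Literature.AlgebraicGeometry.HodgeTheory (cartierDivisorLineBundle complexAbelianVariety_torusUniformised_holds)
open Literature.LinearAlgebra.FreeModule (IsFrobeniusBasis)
open Literature.NumberTheory.Adeles
open Literature.NumberTheory.Automorphic (siegelUpperHalfSpace)
open SiegelModuli

variable {g : ℕ} {δ : Fin g → ℕ}

/-- **From the real `η`-clauses of a symplectic basis to an integral Frobenius basis.**  If `η ∈ NS(X)` and the lattice
basis `b` satisfies `η(Φ b_λᵢ, Φ b_λⱼ) = 0`, `η(Φ b_μᵢ, Φ b_μⱼ) = 0`, `η(Φ b_λᵢ, Φ b_μⱼ) = δᵢ δᵢⱼ` (the clauses of ★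
`ComplexTorus.IsPolarizationType`), then `b` is a Frobenius basis of type `δ` for the integer Gram form
`Matrix.toBilin' (intGram Φ η)` (★ `intCast_toBilin'_intGram`: the two agree after `ℤ → ℝ`).
[cite: Lange2023AbelianVarietiesComplex, §1.5.1 (p. 51) and §3.1] -/
theorem isFrobeniusBasis_of_clauses {ι : Type} [Fintype ι] [DecidableEq ι] {E : Type} [NormedAddCommGroup E]
    [NormedSpace ℂ E] {Φ : (ι → ℝ) ≃L[ℝ] E} {η : E [⋀^Fin 2]→L[ℝ] ℝ} (hη : IsNSForm Φ η)
    (b : Module.Basis (Fin g ⊕ Fin g) ℤ (ι → ℤ))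
    (h₁₁ : ∀ i j, η ![Φ (intVec (b (Sum.inl i))), Φ (intVec (b (Sum.inl j)))] = 0)
    (h₂₂ : ∀ i j, η ![Φ (intVec (b (Sum.inr i))), Φ (intVec (b (Sum.inr j)))] = 0)
    (h₁₂ : ∀ i j, η ![Φ (intVec (b (Sum.inl i))), Φ (intVec (b (Sum.inr j)))] = if i = j then (δ i : ℝ) else 0) :
    IsFrobeniusBasis (Matrix.toBilin' (intGram Φ η)) b δ := by
  have hEv : ∀ m n, ((Matrix.toBilin' (intGram Φ η) m n : ℤ) : ℝ) = η ![Φ (intVec m), Φ (intVec n)] :=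
    intCast_toBilin'_intGram hη
  refine ⟨fun i j => ?_, fun i j => ?_, fun i j => ?_⟩
  · exact_mod_cast (hEv _ _).trans (h₁₁ i j)
  · exact_mod_cast (hEv _ _).trans (h₂₂ i j)
  · have h := (hEv _ _).trans (h₁₂ i j)
    split_ifs at h ⊢ <;> exact_mod_cast h

/-- **THE (U3) EXISTENCE CLAUSE MODULO POSITIVITY** ([Milne2005ShimuraVarieties] Thm. 6.11 «`ℳ_K → G(ℚ)∖X × G(𝔸_f)/K` is
surjective … choose a symplectic basis»; [Deligne1971TravauxShimura] 4.12 (b); [MumfordFogartyKirwan1994] App. 7A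
«`𝒜_{g,δ} × Spec ℂ ≅ ℌ_g/Γ_δ`», existence direction).  Let `δ` be a polarisation type, `0 < g`, `N ≠ 0`, and `P′` a
polarised abelian scheme of type `δ` with level-`N` structure over `Spec ℂ`, with fibre `A`.  ASSUME (`hpos`, R67 (2)):
for every uniformisation `φ : V/Φ(ℤ^ι) → A(ℂ)`, every AMPLE Cartier divisor `Θ` on `A` and every Appell–Humbert datum `p`
of `[𝒪(Θ)^an]`, the form `p.form = c₁` is a Riemann form.  THEN there are the (U3) data — `c ∈ (ℤ/N)^×`, a `ẑ`-unit
`u ≡ c (mod N)`, the principal representative `r = diag(1_g, u·1_g) ∈ K_δ(1)` of multiplier `u` (clauses of ★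
`exists_principalRep` verbatim) — and `Z ∈ 𝔥_g` with `IsAdmissibleAt hδ r Z hZ P′`.  Proof: the chain of the module
docstring. [cite: Milne2005ShimuraVarieties, §6 Thm. 6.11 pp. 74–75 and §12 (63) p. 116]
[cite: Deligne1971TravauxShimura, 4.12 (b) pp. 148–149 and 4.16 p. 150] [cite: MumfordFogartyKirwan1994, App. 7A (pp. 234–235)]
[cite: Lange2023AbelianVarietiesComplex, §3.1.1 Thm. 3.1.2 and §1.5.1] -/
theorem exists_isAdmissibleAt_of_positivity (hδ : IsPolarizationType δ) (hg : 0 < g) {N : ℕ} (hN : N ≠ 0)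
    (P' : PolarizedAbelianSchemeWithLevel g N δ (specOver ℚ ℂ).left)
    (hpos : ∀ {ι : Type} [Fintype ι] [DecidableEq ι]
      (Φ : (ι → ℝ) ≃L[ℝ] (Fin (P'.A.fibre (𝟙 (Spec (CommRingCat.of ℂ)))).toAbelianVariety.dim → ℂ))
      (φ : ComplexTorus Φ → ComplexPoints (P'.A.fibre (𝟙 (Spec (CommRingCat.of ℂ)))).toAbelianVariety.X)
      (hφ : IsAnalytification (Fin (P'.A.fibre (𝟙 (Spec (CommRingCat.of ℂ)))).toAbelianVariety.dim → ℂ)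
        (P'.A.fibre (𝟙 (Spec (CommRingCat.of ℂ)))).toAbelianVariety.X
        (P'.A.fibre (𝟙 (Spec (CommRingCat.of ℂ)))).toAbelianVariety.dim φ)
      (_ : ∀ x y, φ (x + y) = φ x * φ y)
      (Θ : CartierDivisor (P'.A.fibre (𝟙 (Spec (CommRingCat.of ℂ)))).toAbelianVariety.X.left) (_ : Θ.IsAmple)
      (p : AHData Φ) (_ : AHData.toPic p = picClass (cartierDivisorLineBundle hφ Θ)), IsRiemannForm Φ p.form) :
    ∃ (c : (ZMod N)ˣ) (u : finAdeleQˣ) (r : gspFinAdelic δ),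
      (∀ v, Valued.v ((u : finAdeleQ) v) = 1) ∧
      (u : finAdeleQ) - ((c : ZMod N).val : ℕ) ∈ levelIdeal N ∧
      r ∈ principalLevelSubgroup δ 1 ∧
      IsMultiplier (typeFormOver δ finAdeleQ) (r : GL (Fin g ⊕ Fin g) finAdeleQ) u ∧
      ((r : GL (Fin g ⊕ Fin g) finAdeleQ) : Matrix (Fin g ⊕ Fin g) (Fin g ⊕ Fin g) finAdeleQ) =
        Matrix.fromBlocks 1 0 0 ((u : finAdeleQ) • (1 : Matrix (Fin g) (Fin g) finAdeleQ)) ∧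
      ∃ (Z : Matrix (Fin g) (Fin g) ℂ) (hZ : Z ∈ siegelUpperHalfSpace g), IsAdmissibleAt hδ r Z hZ P' := by
  classical
  -- an ample witness `Θ` of the polarisation at the point
  obtain ⟨Θ, hΘ, hlam⟩ := P'.pol.exists_ample ℂ (𝟙 (Spec (CommRingCat.of ℂ)))
  -- uniformise the fibre and take an Appell–Humbert datum of `[𝒪(Θ)^an]`
  obtain ⟨ι, _, _, Φ, φ, hφ, hadd⟩ :=
    complexAbelianVariety_torusUniformised_holds (P'.A.fibre (𝟙 (Spec (CommRingCat.of ℂ)))).toAbelianVariety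
  obtain ⟨p, hp⟩ := AHData.toPic_surjective (picClass (cartierDivisorLineBundle hφ Θ))
  -- positivity (the binder) and the dimension of the fibre
  have hR : IsRiemannForm Φ p.form := hpos Φ φ hφ hadd Θ hΘ p hp
  have hdim : (P'.A.fibre (𝟙 (Spec (CommRingCat.of ℂ)))).toAbelianVariety.dim = g :=
    AbelianSchemeOver.dim_fibre_of_isOfRelDim P'.relDim _
  -- the type of the polarisation is the analytic type of `c₁`
  obtain ⟨-, b, h₁₁, h₂₂, h₁₂⟩ :=
    AbelianSchemeOver.Polarization.HasType.complexTorus_isPolarizationType P'.pol P'.hasType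
      (𝟙 (Spec (CommRingCat.of ℂ))) hlam hφ hadd hdim p hp hR
  have hb : IsFrobeniusBasis (Matrix.toBilin' (intGram Φ p.form)) b δ :=
    isFrobeniusBasis_of_clauses hR.isNSForm b h₁₁ h₂₂ h₁₂
  -- the normal-form marking through the frame of `b`
  obtain ⟨Z, hZ, T, -, hT, -, hmark⟩ :=
    exists_siegelAdelicMarking_normalForm (P'.A.fibre (𝟙 (Spec (CommRingCat.of ℂ)))).toAbelianVariety hdim hδ.1
      φ hφ hadd hR b hb
  obtain ⟨m₀, -, hr⟩ := hmark 1 (one_mem _)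
  exact exists_isAdmissibleAt_of_normalFormFrame hδ hg hN P' Θ hΘ hlam hφ hadd p hp (siegelPeriodEquiv hδ.1 hZ) T hT
    ⟨Z, hZ⟩ (one_mem _) m₀ hr

/-- **B4 (d): SOME PRINCIPAL REPRESENTATIVE IS ADMISSIBLE** — the EXISTENCE half of (U3) in ★
`siegelModuli_complexUniformisation`, unconditionally ([MumfordFogartyKirwan1994] App. 7A «`𝒜_{g,δ} × Spec ℂ ≅ ℌ_g/Γ_δ`»;
[Milne2005ShimuraVarieties] Thm. 6.11 «to `(A, s, ηK)` one attaches `[J, a]` … choose a symplectic basis»;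
[Deligne1971TravauxShimura] 4.12 (b), 4.16).  For a polarisation type `δ`, `0 < g`, `N ≠ 0` and EVERY polarised abelian
scheme `P′` of type `δ` with level-`N` structure over `Spec ℂ` there are the (U3) data — `c ∈ (ℤ/N)^×`, a `ẑ`-unit
`u ≡ c (mod N)`, the principal representative `r = diag(1_g, u·1_g) ∈ K_δ(1)` of multiplier `u` (clauses of ★
`SiegelShimuraSet.exists_principalRep` verbatim) — and a period point `Z ∈ 𝔥_g` with `IsAdmissibleAt hδ r Z hZ P′`: the
fibre is marked by `[J(Z), r]`, with an ample `Θ` (`λ̄ = Λ(𝒪(Θ))`) and a symplectic lift of the level structure whose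
whole tower is read through `r`.  Proof: `exists_isAdmissibleAt_of_positivity` with ★ `isRiemannForm_of_isAmple`.
[cite: MumfordFogartyKirwan1994, App. 7A (pp. 234–235)] [cite: Milne2005ShimuraVarieties, §6 Thm. 6.11 pp. 74–75 and §12 (63) p. 116]
[cite: Deligne1971TravauxShimura, 4.12 (b) pp. 148–149 and 4.16 p. 150] -/
theorem exists_isAdmissibleAt (hδ : IsPolarizationType δ) (hg : 0 < g) {N : ℕ} (hN : N ≠ 0)
    (P' : PolarizedAbelianSchemeWithLevel g N δ (specOver ℚ ℂ).left) :
    ∃ (c : (ZMod N)ˣ) (u : finAdeleQˣ) (r : gspFinAdelic δ),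
      (∀ v, Valued.v ((u : finAdeleQ) v) = 1) ∧
      (u : finAdeleQ) - ((c : ZMod N).val : ℕ) ∈ levelIdeal N ∧
      r ∈ principalLevelSubgroup δ 1 ∧
      IsMultiplier (typeFormOver δ finAdeleQ) (r : GL (Fin g ⊕ Fin g) finAdeleQ) u ∧
      ((r : GL (Fin g ⊕ Fin g) finAdeleQ) : Matrix (Fin g ⊕ Fin g) (Fin g ⊕ Fin g) finAdeleQ) =
        Matrix.fromBlocks 1 0 0 ((u : finAdeleQ) • (1 : Matrix (Fin g) (Fin g) finAdeleQ)) ∧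
      ∃ (Z : Matrix (Fin g) (Fin g) ℂ) (hZ : Z ∈ siegelUpperHalfSpace g), IsAdmissibleAt hδ r Z hZ P' :=
  exists_isAdmissibleAt_of_positivity hδ hg hN P' fun _Φ _φ hφ hadd _Θ hΘ p hp =>
    AbelianVariety.isRiemannForm_of_isAmple _ hφ hadd hΘ p hp

end Literature.AlgebraicGeometry.ModuliOfAbelianVarieties

end
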